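import Summits.AtomisticToContinuum.HydrodynamicLimit.Theses.JParityClosure
import Summits.AtomisticToContinuum.HydrodynamicLimit.Theorems.JParityClosureRateFloorRealisedDatum
import Summits.AtomisticToContinuum.HydrodynamicLimit.Theorems.JParityClosureRateFloorMarkedTransfer
import Summits.AtomisticToContinuum.HydrodynamicLimit.Theorems.JParityClosureRateFloorPathwiseTransfer
import Summits.AtomisticToContinuum.HydrodynamicLimit.Theorems.JParityClosureRateFloorPreemptionCharge
import Summits.AtomisticToContinuum.HydrodynamicLimit.Theorems.JParityClosureRateFloorLineDefs
import Summits.AtomisticToContinuum.HydrodynamicLimit.Theorems.JParityClosureRateFloorNoBurstsRung0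
import Summits.AtomisticToContinuum.HydrodynamicLimit.Theorems.JParityClosureRateFloorStaticFloorRung0Closed
import HarnessLib

/-!
# `RateFloor` at global equilibrium from the two rung-0 leaves (line `Sketch` of the crux
# `JParityClosure.RateFloor`, stmt-AtomisticToContinuum-13080): the composition, importable

Helper file (`--supports stmt-AtomisticToContinuum-13080`) porting the PROVED composition of the lead's skeleton for the
crux `JParityClosure.RateFloor`, line `Sketch` (crux workfile, §7–§9: `lineSW_le_lineSR_add`,
`lineSR_le_collisionFunctional`, `rateFloorAt_of`, `rateFloorRung0_of`) out of the non-importable crux namespace into a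
definition-free `Theorems/` file, with the landed kinematic stubs used as THEOREMS:

* S10 `RateFloorPreemptionCharge.stub_preemptionCharge` (pre-emption charge, per window),
* S8 `RateFloorPathwiseTransfer.stub_pathwiseTransfer` fed with S6d `RateFloorMarkedTransfer.stub_markedTransfer` fed
  with S6a `RateFloorRealisedDatum.stub_realisedDatum` (the pathwise kinetic transfer for the realised functional),
* the line's static functionals `RateFloorLine.{lineSW, lineSR, lineBursts, windowLenB, …}` (definitions file).

**Content.**  Along a hard-sphere trajectory of `N + 1` spheres on `𝕋³` (`0 < ε < 1/2`), for every window length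
`Δ > 0`, horizon `τ ≥ 0` and nonnegative mark `F ≤ M` on `[0, τ]`:
`S_W ≤ S_R + (ε/(N+1))·M·Bursts` (`lineSW_le_lineSR_add`, S10 summed over the windows) and
`S_R ≤ K_N[F]` (`lineSR_le_collisionFunctional`, S8 ∘ S6d ∘ S6a), both SURE inequalities.  Hence, at given profiles
`(a₀, u₀, θ₀)`, the in-probability statements "no bursts" (S7a body) and "static opacity floor with constant `g₃`"
(S7b body) imply the crux body `RateFloorAt g₃` by a union bound with the flow's Liouville-null bad set
(`rateFloorAt_of`: `σ₀ := min σa σb ½`, `η ↦ (η/(3(M+1)), η/3)`, `δ ↦ (δ/2, δ/2)`, `(A, b)` from the burst statement,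
`r₀` from the floor, `N₀ := max`).  Specialised to CONSTANT profiles (global equilibrium, rung 0) this is
`rateFloorRung0_of_leaves : S7a₀ → S7b₀ → RateFloorRung0`, stated with the three registered texts verbatim; `stub_rateFloorRung0`
closes `RateFloorRung0` UNCONDITIONALLY by feeding it the landed rung-0 leaves `RateFloorNoBursts.stub_noBurstsRung0`
(p122968) and `RateFloorStaticFloor.stub_staticOpacityFloorRung0` (p123314).

No definitions, no new mathematics: bookkeeping over landed theorems.

References: Gallagher–Saint-Raymond–Texier 2013 §4.1 (hard-sphere trajectories, collision cylinders); elementary.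
-/

noncomputable section

open scoped BigOperators Topology ENNReal NNReal InnerProductSpace RealInnerProductSpace Classical
open MeasureTheory Set Filter Function
open Literature.Analysis.FluidPDE Literature.MathematicalPhysics.KineticTheory

namespace Summit.AtomisticToContinuum.HydrodynamicLimit.Theorems

namespace RateFloorRung0

open RateFloorLine

/-! ### The two sure inequalities along a hard-sphere trajectory -/

/-- **The would-be transfer, window-summed** (from the landed S10 `RateFloorPreemptionCharge.stub_preemptionCharge`):
for a mark `F ≤ M` on `[0, τ]` (`M ≥ 0`) and any `Δ > 0`, `S_W ≤ S_R + (ε/(N+1))·M·Bursts` along a hard-sphere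
trajectory of `N + 1` spheres on `𝕋³` with `0 < ε < 1/2`. [folklore] -/
theorem lineSW_le_lineSR_add {N : ℕ} {ε : ℝ}
    {γ : ℝ → Config (N + 1) (Fin 3) T3} (htraj : IsHardSphereTrajectory (Torus.geometry (Fin 3)) ε (N + 1) γ)
    (hε : 0 < ε) (hεlt : ε < 2⁻¹) {Δ τ : ℝ} (hΔ : 0 < Δ) (hτ : 0 ≤ τ) (F : ℝ → T3 → T3 → V3 → V3 → ℝ) {M : ℝ}
    (hM : 0 ≤ M) (hFM : ∀ u ∈ Set.Icc 0 τ, ∀ x y v w, F u x y v w ≤ M) :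
    lineSW ε Δ τ γ F ≤ lineSR ε Δ τ γ F + ε / (N + 1 : ℝ) * M * lineBursts ε Δ τ γ := by
  have hwin : ∀ k ∈ Finset.range ⌊τ / Δ⌋₊, wouldBeSum ε Δ (γ (k * Δ)) (k * Δ) F ≤
      realisedSum ε Δ γ (k * Δ) F +
        M * (((multiPairs ε Δ (γ (k * Δ))).card : ℝ) + (secondaryCount ε γ (k * Δ) (k * Δ + Δ) : ℝ)) := by
    intro k hk
    have hk' : ((k : ℝ) + 1) * Δ ≤ τ := by
      have h1 : (k : ℝ) + 1 ≤ ⌊τ / Δ⌋₊ := by exact_mod_cast Nat.succ_le_of_lt (Finset.mem_range.1 hk)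
      have h2 : ((⌊τ / Δ⌋₊ : ℕ) : ℝ) ≤ τ / Δ := Nat.floor_le (div_nonneg hτ hΔ.le)
      calc ((k : ℝ) + 1) * Δ ≤ (τ / Δ) * Δ := mul_le_mul_of_nonneg_right (h1.trans h2) hΔ.le
        _ = τ := div_mul_cancel₀ τ hΔ.ne'
    have hk0 : 0 ≤ (k : ℝ) * Δ := mul_nonneg k.cast_nonneg hΔ.le
    have hsub : ∀ u ∈ Set.Ioc ((k : ℝ) * Δ) (k * Δ + Δ), u ∈ Set.Icc 0 τ := fun u hu =>
      ⟨hk0.trans hu.1.le, hu.2.trans (by linarith)⟩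
    have key := RateFloorPreemptionCharge.stub_preemptionCharge (N + 1) ε γ htraj hε hεlt (k * Δ) (k * Δ + Δ)
      (by linarith) F M hM
      (fun u hu x y v w => hFM u (hsub u hu) x y v w)
      (fun p => firstContact ε Δ (γ (k * Δ)) p) (fun p => by rw [add_sub_cancel_left]; rfl)
      (wouldBePairs ε Δ (γ (k * Δ))) (by rw [add_sub_cancel_left]; rfl)
      (realisedPairs ε Δ γ (k * Δ)) (by rw [add_sub_cancel_left]; rfl)
      (multiPairs ε Δ (γ (k * Δ))) rfl
      (secondaryCount ε γ (k * Δ) (k * Δ + Δ)) rfl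
    simpa only [wouldBeSum, realisedSum] using key
  have hn : (0 : ℝ) < ((N + 1 : ℕ) : ℝ) := by positivity
  have hn1 : ((N + 1 : ℕ) : ℝ) = (N + 1 : ℝ) := by push_cast; ring
  have hsum := Finset.sum_le_sum hwin
  rw [Finset.sum_add_distrib, ← Finset.mul_sum] at hsum
  have hSW : lineSW ε Δ τ γ F =
      ε / ((N + 1 : ℕ) : ℝ) * ∑ k ∈ Finset.range ⌊τ / Δ⌋₊, wouldBeSum ε Δ (γ (k * Δ)) (k * Δ) F := rfl
  have hSR : lineSR ε Δ τ γ F =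
      ε / ((N + 1 : ℕ) : ℝ) * ∑ k ∈ Finset.range ⌊τ / Δ⌋₊, realisedSum ε Δ γ (k * Δ) F := rfl
  have hBu : lineBursts ε Δ τ γ = ∑ k ∈ Finset.range ⌊τ / Δ⌋₊,
      (((multiPairs ε Δ (γ (k * Δ))).card : ℝ) + (secondaryCount ε γ (k * Δ) (k * Δ + Δ) : ℝ)) := rfl
  rw [hSW, hSR, hBu, ← hn1]
  calc ε / ((N + 1 : ℕ) : ℝ) * ∑ k ∈ Finset.range ⌊τ / Δ⌋₊, wouldBeSum ε Δ (γ (k * Δ)) (k * Δ) F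
      ≤ ε / ((N + 1 : ℕ) : ℝ) * (∑ k ∈ Finset.range ⌊τ / Δ⌋₊, realisedSum ε Δ γ (k * Δ) F +
          M * ∑ k ∈ Finset.range ⌊τ / Δ⌋₊,
            (((multiPairs ε Δ (γ (k * Δ))).card : ℝ) + (secondaryCount ε γ (k * Δ) (k * Δ + Δ) : ℝ))) :=
        mul_le_mul_of_nonneg_left hsum (div_nonneg hε.le hn.le)
    _ = _ := by ring

/-- **The kinetic transfer as a SURE inequality** (the landed S8 `RateFloorPathwiseTransfer.stub_pathwiseTransfer` fed
with the landed S6d `RateFloorMarkedTransfer.stub_markedTransfer`, itself fed with the landed S6a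
`RateFloorRealisedDatum.stub_realisedDatum`): on a hard-sphere trajectory of `N + 1` spheres with `0 < ε < 1/2`, for
every `Δ > 0`, `τ ≥ 0` and nonnegative mark `F`, `S_R ≤` the collision functional of `[0, τ]` with the same mark read
at the reflected current velocities. [folklore] -/
theorem lineSR_le_collisionFunctional {N : ℕ}
    {ε : ℝ} {γ : ℝ → Config (N + 1) (Fin 3) T3} (htraj : IsHardSphereTrajectory (Torus.geometry (Fin 3)) ε (N + 1) γ)
    (hε : 0 < ε) (hεlt : ε < 2⁻¹) {Δ τ : ℝ} (hΔ : 0 < Δ) (hτ : 0 ≤ τ) (F : ℝ → T3 → T3 → V3 → V3 → ℝ)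
    (hF : ∀ u x y v w, 0 ≤ F u x y v w) :
    lineSR ε Δ τ γ F ≤ ε / (N + 1 : ℝ) *
      ∑ᶠ (u : ℝ) (_ : u ∈ collisionTimes (Torus.geometry (Fin 3)) ε γ ∩ Set.Icc 0 τ),
        ∑ i : Fin (N + 1), ∑ j : Fin (N + 1),
          (if i ≠ j ∧ ‖(Torus.geometry (Fin 3)).sepVec (γ u i).1 (γ u j).1‖ = ε then
            F u (γ u i).1 (γ u j).1
              (reflectVel ((Torus.geometry (Fin 3)).sepVec (γ u i).1 (γ u j).1) ((γ u i).2, (γ u j).2)).1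
              (reflectVel ((Torus.geometry (Fin 3)).sepVec (γ u i).1 (γ u j).1) ((γ u i).2, (γ u j).2)).2
          else 0) := by
  have key := RateFloorPathwiseTransfer.stub_pathwiseTransfer
    (RateFloorMarkedTransfer.stub_markedTransfer RateFloorRealisedDatum.stub_realisedDatum)
    (N + 1) ε γ htraj hε hεlt Δ τ hΔ hτ F hF
    (fun k p => firstContact ε Δ (γ (k * Δ)) p) (fun k p => rfl)
    (fun k => realisedPairs ε Δ γ (k * Δ)) (fun k => rfl)
  have hn : (0 : ℝ) ≤ (N + 1 : ℝ) := by positivity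
  have hn1 : ((N + 1 : ℕ) : ℝ) = (N + 1 : ℝ) := by push_cast; ring
  have hSR : lineSR ε Δ τ γ F = ε / ((N + 1 : ℕ) : ℝ) * ∑ k ∈ Finset.range ⌊τ / Δ⌋₊,
      ∑ p ∈ realisedPairs ε Δ γ (k * Δ),
        F (k * Δ + firstContact ε Δ (γ (k * Δ)) p)
          (freeFlight (Torus.geometry (Fin 3)) (firstContact ε Δ (γ (k * Δ)) p) (γ (k * Δ)) p.1).1
          (freeFlight (Torus.geometry (Fin 3)) (firstContact ε Δ (γ (k * Δ)) p) (γ (k * Δ)) p.2).1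
          ((γ (k * Δ) p.1).2) ((γ (k * Δ) p.2).2) := rfl
  rw [hSR, hn1]
  exact mul_le_mul_of_nonneg_left key (div_nonneg hε.le hn)

/-! ### Elementary helpers of the composition -/

/-- A continuous weight is bounded on the compact slab `[0, τ] × 𝕋³`. [folklore] -/
theorem exists_bound_on_slab (χ : ℝ × UnitAddTorus (Fin 3) → ℝ) (hχ : Continuous χ) (τ : ℝ) :
    ∃ Mχ : ℝ, 0 ≤ Mχ ∧ ∀ u ∈ Set.Icc (0 : ℝ) τ, ∀ x : UnitAddTorus (Fin 3), χ (u, x) ≤ Mχ := by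
  have hK : IsCompact ((Set.Icc (0 : ℝ) τ) ×ˢ (Set.univ : Set (UnitAddTorus (Fin 3)))) :=
    isCompact_Icc.prod isCompact_univ
  obtain ⟨C, hC⟩ := hK.bddAbove_image hχ.continuousOn
  refine ⟨max C 0, le_max_right _ _, fun u hu x => (le_max_left C 0).trans' ?_⟩
  exact hC ⟨(u, x), ⟨hu, Set.mem_univ _⟩, rfl⟩

/-- The arithmetic of the three-way split of `η` (kept separate so that no tactic normalises the crux's large
subterms): `K ≥ S_R ≥ S_W − X`, `X ≤ η/3`, `S_W ≥ I − η/3` contradict `K < I − η`. [folklore] -/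
theorem deficit_arith {K SR SW X I η : ℝ} (hη : 0 < η) (hz : K < I - η) (hKR : SR ≤ K) (hWR : SW ≤ SR + X)
    (hX : X ≤ η / 3) (hcb : ¬ SW < I - η / 3) : False := by
  push Not at hcb
  linarith

/-- `M·(ε/n·Bu) ≤ η/3` from `ε/n·Bu ≤ η/(3(M+1))`. [folklore] -/
theorem burst_term_le {M c Bu η : ℝ} (hM : 0 ≤ M) (hη : 0 < η)
    (hca : ¬ η / (3 * (M + 1)) < c * Bu) : c * M * Bu ≤ η / 3 := by
  have h1 : c * M * Bu = M * (c * Bu) := by ring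
  have h2 : M * (c * Bu) ≤ M * (η / (3 * (M + 1))) := mul_le_mul_of_nonneg_left (not_lt.1 hca) hM
  have h3 : M * (η / (3 * (M + 1))) = η / 3 * (M / (M + 1)) := by
    field_simp
  have h4 : M / (M + 1) ≤ 1 := (div_le_one (by linarith)).2 (by linarith)
  have h5 : η / 3 * (M / (M + 1)) ≤ η / 3 := mul_le_of_le_one_right (by linarith) h4
  linarith

/-! ### The composition at given profiles -/

/-- **The composition AT GIVEN PROFILES** (the one proof behind both the general and the rung-0 compositions): the
sure transfer `K ≥ S_R ≥ S_W − (ε/n)·M·Bursts` on good points of the flow (landed S6a, S6d, S8, S10 used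
as theorems), the burst event from the body of S7a `NoBursts` at the profiles `(a₀, u₀, θ₀)` (hypothesis `hA`) and
the static floor from the body of S7b `StaticOpacityFloor` with constant `g₃` (hypothesis `hB`), by a union bound with the
flow's Liouville-null bad set (`particleLaw` is a `withDensity`): `σ₀ := min σa σb ½`, `η ↦ (η/(3(M+1)), η/3)`,
`δ ↦ (δ/2, δ/2)`, `(A, b)` from the burst statement, `r₀` from the floor, `N₀ := max`; the floor constant passes
through unchanged (`g₀ = g₃`).  The conclusion is the body of the crux `RateFloor` at the profiles with `g₀ := g₃`,
verbatim. [folklore] -/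
theorem rateFloorAt_of
    {a₀ θ₀ : Literature.MathematicalPhysics.KineticTheory.T3 → ℝ}
    {u₀ : Literature.MathematicalPhysics.KineticTheory.T3 → Literature.MathematicalPhysics.KineticTheory.V3} {g₃ : ℝ}
    (hA : ∃ σ₀ : ℝ, 0 < σ₀ ∧ ∀ σ : ℝ, 0 < σ → σ < σ₀ → ∀ Φ : (N : ℕ) → Literature.Analysis.FluidPDE.HardSphereFlow (Literature.Analysis.FluidPDE.Torus.geometry (Fin 3)) (Literature.MathematicalPhysics.KineticTheory.hsDiameter σ N) (N + 1), ∀ τ : ℝ, 0 < τ → ∀ η δ : ℝ, 0 < η → 0 < δ → ∃ A : ℝ, 0 < A ∧ ∃ b : ℝ, 1 / 3 ≤ b ∧ b ≤ 1 ∧ ∃ N₀ : ℕ, ∀ N : ℕ, N₀ ≤ N → let ε := Literature.MathematicalPhysics.KineticTheory.hsDiameter σ N; let γ := fun z (s : ℝ) => (Φ N).flow s z; Literature.MathematicalPhysics.KineticTheory.localGibbsLaw σ a₀ u₀ θ₀ N (Φ N) {z | η < ε / (N + 1 : ℝ) * lineBursts ε (windowLenB A b N) τ (γ z)} ≤ ENNReal.ofReal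 δ)
    (hB : ∃ σ₀ : ℝ, 0 < σ₀ ∧ ∀ σ : ℝ, 0 < σ → σ < σ₀ → ∀ Φ : (N : ℕ) → Literature.Analysis.FluidPDE.HardSphereFlow (Literature.Analysis.FluidPDE.Torus.geometry (Fin 3)) (Literature.MathematicalPhysics.KineticTheory.hsDiameter σ N) (N + 1), ∀ τ : ℝ, 0 < τ → ∀ χ : ℝ × UnitAddTorus (Fin 3) → ℝ, Continuous χ → (∀ p, 0 ≤ χ p) → ∀ Ξ : EuclideanSpace ℝ (Fin 3) × EuclideanSpace ℝ (Fin 3) × EuclideanSpace ℝ (Fin 3) → ℝ, Continuous Ξ → (∀ q, 0 ≤ Ξ q) → (∃ C : ℝ, ∀ q, Ξ q ≤ C) → ∀ η δ : ℝ, 0 < η → 0 < δ → ∃ r₀ : ℝ, 0 < r₀ ∧ ∀ r : ℝ, 0 < r → r < r₀ → ∀ A : ℝ, 0 < A → ∀ b : ℝ, 1 / 3 ≤ b → b ≤ 1 → ∃ N₀ : ℕ, ∀ N : ℕ, N₀ ≤ N → let ε := Literature.MathematicalPhysics.KineticTheory.hsDiameter σ N; let G := Literature.Analysis.FluidPDE.Torus.geometry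 (Fin 3); let γ := fun z (s : ℝ) => (Φ N).flow s z; let bx : UnitAddTorus (Fin 3) → UnitAddTorus (Fin 3) → ℝ := fun x y => 3 / (Real.pi * r ^ 3) * max (1 - Literature.Analysis.FluidPDE.Torus.euclidDist x y / r) 0; let Θ := fun (Ξ : EuclideanSpace ℝ (Fin 3) × EuclideanSpace ℝ (Fin 3) × EuclideanSpace ℝ (Fin 3) → ℝ) (v w : EuclideanSpace ℝ (Fin 3)) => ∫ ω : Metric.sphere (0 : EuclideanSpace ℝ (Fin 3)) 1, Ξ ((ω : EuclideanSpace ℝ (Fin 3)), v, w) * Literature.MathematicalPhysics.KineticTheory.hardSphereKernel (w, v) ω ∂Literature.MathematicalPhysics.KineticTheory.sphereMeasure; let B := fun Ξ z s (x₀ : UnitAddTorus (Fin 3)) => ∫ p, bx p.1.1 x₀ * bx p.2.1 x₀ * Θ Ξ p.1.2 p.2.2 ∂((Literature.Analysis.FluidPDE.empiricalMeasure (γ z s)).prod (Literature.Analysis.FluidPDE.empiricalMeasure (γ z s))); let SW := fun (z : Literature.Analysis.FluidPDE.Config (N + 1) (Fin 3) Literature.MathematicalPhysics.KineticTheory.T3)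 => lineSW ε (windowLenB A b N) τ (γ z) (fun u x y v w => χ (u, x) * Ξ (ε⁻¹ • G.sepVec x y, v, w)); Literature.MathematicalPhysics.KineticTheory.localGibbsLaw σ a₀ u₀ θ₀ N (Φ N) {z | SW z < g₃ * σ ^ 3 * (∫ s in Set.Icc (0 : ℝ) τ, ∫ x : UnitAddTorus (Fin 3), χ (s, x) * B Ξ z s x) - η} ≤ ENNReal.ofReal δ) :
    ∃ σ₀ : ℝ, 0 < σ₀ ∧ ∀ σ : ℝ, 0 < σ → σ < σ₀ → ∀ Φ : (N : ℕ) → Literature.Analysis.FluidPDE.HardSphereFlow (Literature.Analysis.FluidPDE.Torus.geometry (Fin 3)) (Literature.MathematicalPhysics.KineticTheory.hsDiameter σ N) (N + 1), ∀ τ : ℝ, 0 < τ → ∀ χ : ℝ × UnitAddTorus (Fin 3) → ℝ, Continuous χ → (∀ p, 0 ≤ χ p) → ∀ Ξ : EuclideanSpace ℝ (Fin 3) × EuclideanSpace ℝ (Fin 3) × EuclideanSpace ℝ (Fin 3) → ℝ, Continuous Ξ → (∀ q, 0 ≤ Ξ q) → (∃ C : ℝ, ∀ q, Ξ q ≤ C)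 → ∀ η δ : ℝ, 0 < η → 0 < δ → ∃ r₀ : ℝ, 0 < r₀ ∧ ∀ r : ℝ, 0 < r → r < r₀ → ∃ N₀ : ℕ, ∀ N : ℕ, N₀ ≤ N → let ε := Literature.MathematicalPhysics.KineticTheory.hsDiameter σ N; let G := Literature.Analysis.FluidPDE.Torus.geometry (Fin 3); let γ := fun z (s : ℝ) => (Φ N).flow s z; let bx : UnitAddTorus (Fin 3) → UnitAddTorus (Fin 3) → ℝ := fun x y => 3 / (Real.pi * r ^ 3) * max (1 - Literature.Analysis.FluidPDE.Torus.euclidDist x y / r) 0; let Θ := fun (Ξ : EuclideanSpace ℝ (Fin 3) × EuclideanSpace ℝ (Fin 3) × EuclideanSpace ℝ (Fin 3) → ℝ) (v w : EuclideanSpace ℝ (Fin 3)) => ∫ ω : Metric.sphere (0 : EuclideanSpace ℝ (Fin 3)) 1, Ξ ((ω : EuclideanSpace ℝ (Fin 3)), v, w) * Literature.MathematicalPhysics.KineticTheory.hardSphereKernel (w, v) ω ∂Literature.MathematicalPhysics.KineticTheory.sphereMeasure; let B := fun Ξ z s (x₀ : UnitAddTorus (Fin 3)) => ∫ p, bx p.1.1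 x₀ * bx p.2.1 x₀ * Θ Ξ p.1.2 p.2.2 ∂((Literature.Analysis.FluidPDE.empiricalMeasure (γ z s)).prod (Literature.Analysis.FluidPDE.empiricalMeasure (γ z s))); let pv := fun z s (i j : Fin (N + 1)) => Literature.Analysis.FluidPDE.reflectVel (G.sepVec (γ z s i).1 (γ z s j).1) ((γ z s i).2, (γ z s j).2); let Kc := fun (Fn : Literature.Analysis.FluidPDE.Config (N + 1) (Fin 3) Literature.MathematicalPhysics.KineticTheory.T3 → ℝ → Fin (N + 1) → Fin (N + 1) → ℝ) z => ε / (N + 1 : ℝ) * ∑ᶠ (s : ℝ) (_ : s ∈ Literature.Analysis.FluidPDE.collisionTimes G ε (γ z) ∩ Set.Icc 0 τ), ∑ i : Fin (N + 1), ∑ j : Fin (N + 1), (if i ≠ j ∧ ‖G.sepVec (γ z s i).1 (γ z s j).1‖ = ε then Fn z s i j else 0); Literature.MathematicalPhysics.KineticTheory.localGibbsLaw σ a₀ u₀ θ₀ N (Φ N) {z | Kc (fun z s i j => χ (s, (γ z s i).1) * Ξ (ε⁻¹ • G.sepVec (γ z s i).1 (γ z s j).1, (pv z s i j).1, (pv z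 s i j).2)) z < g₃ * σ ^ 3 * (∫ s in Set.Icc (0 : ℝ) τ, ∫ x : UnitAddTorus (Fin 3), χ (s, x) * B Ξ z s x) - η} ≤ ENNReal.ofReal δ := by
  obtain ⟨σa, hσa, hA⟩ := hA
  obtain ⟨σb, hσb, hB⟩ := hB
  refine ⟨min (min σa σb) 2⁻¹, lt_min (lt_min hσa hσb) (by norm_num), ?_⟩
  intro σ hσ hσlt Φ τ hτ χ hχc hχ0 Ξ hΞc hΞ0 hΞC η δ hη hδ
  have hσa' : σ < σa := hσlt.trans_le ((min_le_left _ _).trans (min_le_left _ _))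
  have hσb' : σ < σb := hσlt.trans_le ((min_le_left _ _).trans (min_le_right _ _))
  have hσ2 : σ < 2⁻¹ := hσlt.trans_le (min_le_right _ _)
  -- a bound `M` on the mark `χ·Ξ` over `[0, τ]`
  obtain ⟨C, hC⟩ := hΞC
  obtain ⟨Mχ, hMχ0, hMχ⟩ := exists_bound_on_slab χ hχc τ
  obtain ⟨M, hM0, hMb⟩ : ∃ M : ℝ, 0 ≤ M ∧ ∀ u ∈ Set.Icc (0 : ℝ) τ, ∀ (x : UnitAddTorus (Fin 3))
      (q : EuclideanSpace ℝ (Fin 3) × EuclideanSpace ℝ (Fin 3) × EuclideanSpace ℝ (Fin 3)), χ (u, x) * Ξ q ≤ M :=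
    ⟨Mχ * max C 0, mul_nonneg hMχ0 (le_max_right _ _), fun u hu x q =>
      mul_le_mul (hMχ u hu x) ((hC q).trans (le_max_left _ _)) (hΞ0 q) hMχ0⟩
  -- S7a with `η/(3(M+1))`, `δ/2`
  have hηa : 0 < η / (3 * (M + 1)) := div_pos hη (by positivity)
  obtain ⟨A, hApos, b, hb1, hb2, Na, hA⟩ := hA σ hσ hσa' Φ τ hτ (η / (3 * (M + 1))) (δ / 2) hηa (half_pos hδ)
  -- S7b with `η/3`, `δ/2`
  obtain ⟨r₀, hr₀, hB⟩ := hB σ hσ hσb' Φ τ hτ χ hχc hχ0 Ξ hΞc hΞ0 ⟨C, hC⟩ (η / 3) (δ / 2) (by positivity)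
    (half_pos hδ)
  refine ⟨r₀, hr₀, ?_⟩
  intro r hr hrlt
  obtain ⟨Nb, hB⟩ := hB r hr hrlt A hApos b hb1 hb2
  refine ⟨max Na Nb, ?_⟩
  intro N hN
  have h1 := hA N ((le_max_left _ _).trans hN)
  have h2 := hB N ((le_max_right _ _).trans hN)
  intro ε G γ bx Θ B pv Kc
  have e1 : Literature.MathematicalPhysics.KineticTheory.localGibbsLaw σ a₀ u₀ θ₀ N (Φ N)
      {z | η / (3 * (M + 1)) < ε / (N + 1 : ℝ) * lineBursts ε (windowLenB A b N) τ (γ z)} ≤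
      ENNReal.ofReal (δ / 2) := h1
  have e2 : Literature.MathematicalPhysics.KineticTheory.localGibbsLaw σ a₀ u₀ θ₀ N (Φ N)
      {z | lineSW ε (windowLenB A b N) τ (γ z) (fun u x y v w => χ (u, x) * Ξ (ε⁻¹ • G.sepVec x y, v, w)) <
        g₃ * σ ^ 3 * (∫ s in Set.Icc (0 : ℝ) τ, ∫ x : UnitAddTorus (Fin 3), χ (s, x) * B Ξ z s x) - η / 3} ≤
      ENNReal.ofReal (δ / 2) := h2
  -- facts along good trajectories
  have hε : 0 < ε := hsDiameter_pos hσ N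
  have hεlt : ε < 2⁻¹ := (hsDiameter_le hσ.le N).trans_lt hσ2
  have hΔ : 0 < windowLenB A b N := mul_pos hApos (Real.rpow_pos_of_pos (by positivity) _)
  have hF0 : ∀ (u : ℝ) (x y : T3) (v w : V3), 0 ≤ χ (u, x) * Ξ (ε⁻¹ • G.sepVec x y, v, w) :=
    fun u x y v w => mul_nonneg (hχ0 _) (hΞ0 _)
  have hFM : ∀ u ∈ Set.Icc (0 : ℝ) τ, ∀ (x y : T3) (v w : V3), χ (u, x) * Ξ (ε⁻¹ • G.sepVec x y, v, w) ≤ M :=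
    fun u hu x y v w => hMb u hu x _
  have hgood : Literature.MathematicalPhysics.KineticTheory.localGibbsLaw σ a₀ u₀ θ₀ N (Φ N) (Φ N).goodᶜ = 0 := by
    rw [Literature.MathematicalPhysics.KineticTheory.localGibbsLaw, particleLaw_eq]
    exact withDensity_absolutelyContinuous _ _ (Φ N).measure_compl_good
  have hsub : {z | Kc (fun z s i j => χ (s, (γ z s i).1) *
        Ξ (ε⁻¹ • G.sepVec (γ z s i).1 (γ z s j).1, (pv z s i j).1, (pv z s i j).2)) z <
        g₃ * σ ^ 3 * (∫ s in Set.Icc (0 : ℝ) τ, ∫ x : UnitAddTorus (Fin 3), χ (s, x) * B Ξ z s x) - η} ⊆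
      {z | η / (3 * (M + 1)) < ε / (N + 1 : ℝ) * lineBursts ε (windowLenB A b N) τ (γ z)} ∪
      {z | lineSW ε (windowLenB A b N) τ (γ z) (fun u x y v w => χ (u, x) * Ξ (ε⁻¹ • G.sepVec x y, v, w)) <
        g₃ * σ ^ 3 * (∫ s in Set.Icc (0 : ℝ) τ, ∫ x : UnitAddTorus (Fin 3), χ (s, x) * B Ξ z s x) - η / 3} ∪
      (Φ N).goodᶜ := by
    intro z hz
    by_contra hcon
    have hca : ¬ (η / (3 * (M + 1)) < ε / (N + 1 : ℝ) * lineBursts ε (windowLenB A b N) τ (γ z)) :=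
      fun h => hcon (Or.inl (Or.inl h))
    have hcb : ¬ (lineSW ε (windowLenB A b N) τ (γ z) (fun u x y v w => χ (u, x) * Ξ (ε⁻¹ • G.sepVec x y, v, w)) <
        g₃ * σ ^ 3 * (∫ s in Set.Icc (0 : ℝ) τ, ∫ x : UnitAddTorus (Fin 3), χ (s, x) * B Ξ z s x) - η / 3) :=
      fun h => hcon (Or.inl (Or.inr h))
    have hzg : z ∈ (Φ N).good := by
      by_contra h
      exact hcon (Or.inr h)
    have htraj : IsHardSphereTrajectory G ε (N + 1) (γ z) := (Φ N).isTrajectory z hzg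
    -- sure transfer: K ≥ S_R ≥ S_W - (ε/n) M Bursts
    have hKR := lineSR_le_collisionFunctional htraj hε hεlt hΔ hτ.le
      (fun u x y v w => χ (u, x) * Ξ (ε⁻¹ • G.sepVec x y, v, w)) hF0
    have hWR := lineSW_le_lineSR_add htraj hε hεlt hΔ hτ.le
      (fun u x y v w => χ (u, x) * Ξ (ε⁻¹ • G.sepVec x y, v, w)) hM0 hFM
    -- the burst term is at most η/3
    have hB3 := burst_term_le hM0 hη hca
    have hz' : Kc (fun z s i j => χ (s, (γ z s i).1) *
        Ξ (ε⁻¹ • G.sepVec (γ z s i).1 (γ z s j).1, (pv z s i j).1, (pv z s i j).2)) z <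
        g₃ * σ ^ 3 * (∫ s in Set.Icc (0 : ℝ) τ, ∫ x : UnitAddTorus (Fin 3), χ (s, x) * B Ξ z s x) - η := hz
    exact deficit_arith hη hz' hKR hWR hB3 hcb
  calc Literature.MathematicalPhysics.KineticTheory.localGibbsLaw σ a₀ u₀ θ₀ N (Φ N) _
      ≤ Literature.MathematicalPhysics.KineticTheory.localGibbsLaw σ a₀ u₀ θ₀ N (Φ N) (_ ∪ _ ∪ (Φ N).goodᶜ) :=
        measure_mono hsub
    _ ≤ Literature.MathematicalPhysics.KineticTheory.localGibbsLaw σ a₀ u₀ θ₀ N (Φ N) _ +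
          Literature.MathematicalPhysics.KineticTheory.localGibbsLaw σ a₀ u₀ θ₀ N (Φ N) _ +
          Literature.MathematicalPhysics.KineticTheory.localGibbsLaw σ a₀ u₀ θ₀ N (Φ N) (Φ N).goodᶜ :=
        (measure_union_le _ _).trans (add_le_add (measure_union_le _ _) le_rfl)
    _ ≤ ENNReal.ofReal (δ / 2) + ENNReal.ofReal (δ / 2) + 0 := add_le_add (add_le_add e1 e2) hgood.le
    _ = ENNReal.ofReal δ := by
        rw [add_zero, ← ENNReal.ofReal_add (half_pos hδ).le (half_pos hδ).le, add_halves]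

/-! ### The crux from the two general leaves (the line's composition, importable) -/

/-- **`RateFloor` from the two open leaves of line `Sketch`** — registered stub `stub_rateFloor_of_leaves` of crux
stmt-AtomisticToContinuum-13080: S7a `NoBursts` (first hypothesis, the registered text verbatim) and S7b `StaticOpacityFloor`
(second hypothesis, verbatim) imply the crux `JParityClosure.RateFloor` itself, `g₀ := g₃`, profile by profile through
`rateFloorAt_of`.  This is the def-free tree copy of the skeleton theorem `rateFloor_of_noBursts_staticFloor` (crux workfile
`Cruxes/RateFloor/Lines/Sketch.lean`): if the planner promotes S7a / S7b to statement items, this theorem is their assembly.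
Both leaves are research-open for general profiles (law of the non-equilibrium hard-sphere flow at macroscopic times; crux
`Disproof.lean` §6); at constant profiles they are the landed `RateFloorNoBursts.stub_noBurstsRung0`,
`RateFloorStaticFloor.stub_staticOpacityFloorRung0` (see `stub_rateFloorRung0` below). [folklore] -/
theorem stub_rateFloor_of_leaves :
    (∀ (a₀ θ₀ : Literature.MathematicalPhysics.KineticTheory.T3 → ℝ) (u₀ : Literature.MathematicalPhysics.KineticTheory.T3 → Literature.MathematicalPhysics.KineticTheory.V3), Continuous a₀ → Continuous θ₀ → Continuous u₀ → (∀ x, 0 < a₀ x) → (∀ x, 0 < θ₀ x) → ∃ σ₀ : ℝ, 0 < σ₀ ∧ ∀ σ : ℝ, 0 < σ → σ < σ₀ → ∀ Φ : (N : ℕ) → Literature.Analysis.FluidPDE.HardSphereFlow (Literature.Analysis.FluidPDE.Torus.geometry (Fin 3)) (Literature.MathematicalPhysics.KineticTheory.hsDiameter σ N) (N + 1), ∀ τ : ℝ, 0 < τ → ∀ η δ : ℝ, 0 < η → 0 < δ → ∃ A : ℝ, 0 < A ∧ ∃ b : ℝ, 1 / 3 ≤ b ∧ b ≤ 1 ∧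 ∃ N₀ : ℕ, ∀ N : ℕ, N₀ ≤ N → let ε := Literature.MathematicalPhysics.KineticTheory.hsDiameter σ N; let γ := fun z (s : ℝ) => (Φ N).flow s z; Literature.MathematicalPhysics.KineticTheory.localGibbsLaw σ a₀ u₀ θ₀ N (Φ N) {z | η < ε / (N + 1 : ℝ) * lineBursts ε (windowLenB A b N) τ (γ z)} ≤ ENNReal.ofReal δ) →
    (∃ g₃ : ℝ, 0 < g₃ ∧ ∀ (a₀ θ₀ : Literature.MathematicalPhysics.KineticTheory.T3 → ℝ) (u₀ : Literature.MathematicalPhysics.KineticTheory.T3 → Literature.MathematicalPhysics.KineticTheory.V3), Continuous a₀ → Continuous θ₀ → Continuous u₀ → (∀ x, 0 < a₀ x) → (∀ x, 0 < θ₀ x) → ∃ σ₀ : ℝ, 0 < σ₀ ∧ ∀ σ : ℝ, 0 < σ → σ < σ₀ → ∀ Φ : (N : ℕ) → Literature.Analysis.FluidPDE.HardSphereFlow (Literature.Analysis.FluidPDE.Torus.geometry (Fin 3)) (Literature.MathematicalPhysics.KineticTheory.hsDiameter σ N) (N + 1), ∀ τ : ℝ, 0 < τ → ∀ χ : ℝ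 × UnitAddTorus (Fin 3) → ℝ, Continuous χ → (∀ p, 0 ≤ χ p) → ∀ Ξ : EuclideanSpace ℝ (Fin 3) × EuclideanSpace ℝ (Fin 3) × EuclideanSpace ℝ (Fin 3) → ℝ, Continuous Ξ → (∀ q, 0 ≤ Ξ q) → (∃ C : ℝ, ∀ q, Ξ q ≤ C) → ∀ η δ : ℝ, 0 < η → 0 < δ → ∃ r₀ : ℝ, 0 < r₀ ∧ ∀ r : ℝ, 0 < r → r < r₀ → ∀ A : ℝ, 0 < A → ∀ b : ℝ, 1 / 3 ≤ b → b ≤ 1 → ∃ N₀ : ℕ, ∀ N : ℕ, N₀ ≤ N → let ε := Literature.MathematicalPhysics.KineticTheory.hsDiameter σ N; let G := Literature.Analysis.FluidPDE.Torus.geometry (Fin 3); let γ := fun z (s : ℝ) => (Φ N).flow s z; let bx : UnitAddTorus (Fin 3) → UnitAddTorus (Fin 3) → ℝ := fun x y => 3 / (Real.pi * r ^ 3) * max (1 - Literature.Analysis.FluidPDE.Torus.euclidDist x y / r) 0; let Θ := fun (Ξ : EuclideanSpace ℝ (Fin 3) × EuclideanSpace ℝ (Fin 3) × EuclideanSpace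 ℝ (Fin 3) → ℝ) (v w : EuclideanSpace ℝ (Fin 3)) => ∫ ω : Metric.sphere (0 : EuclideanSpace ℝ (Fin 3)) 1, Ξ ((ω : EuclideanSpace ℝ (Fin 3)), v, w) * Literature.MathematicalPhysics.KineticTheory.hardSphereKernel (w, v) ω ∂Literature.MathematicalPhysics.KineticTheory.sphereMeasure; let B := fun Ξ z s (x₀ : UnitAddTorus (Fin 3)) => ∫ p, bx p.1.1 x₀ * bx p.2.1 x₀ * Θ Ξ p.1.2 p.2.2 ∂((Literature.Analysis.FluidPDE.empiricalMeasure (γ z s)).prod (Literature.Analysis.FluidPDE.empiricalMeasure (γ z s))); let SW := fun (z : Literature.Analysis.FluidPDE.Config (N + 1) (Fin 3) Literature.MathematicalPhysics.KineticTheory.T3) => lineSW ε (windowLenB A b N) τ (γ z) (fun u x y v w => χ (u, x) * Ξ (ε⁻¹ • G.sepVec x y, v, w)); Literature.MathematicalPhysics.KineticTheory.localGibbsLaw σ a₀ u₀ θ₀ N (Φ N) {z | SW z < g₃ * σ ^ 3 * (∫ s in Set.Icc (0 : ℝ) τ, ∫ x : UnitAddTorus (Fin 3), χ (s, x) * B Ξ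 z s x) - η} ≤ ENNReal.ofReal δ) →
    Summit.AtomisticToContinuum.HydrodynamicLimit.Theses.JParityClosure.RateFloor := by
  intro hS7a hS7b
  obtain ⟨g₃, hg₃, hB⟩ := hS7b
  exact ⟨g₃, hg₃, fun a₀ θ₀ u₀ ha hθ hu ha0 hθ0 =>
    rateFloorAt_of (hS7a a₀ θ₀ u₀ ha hθ hu ha0 hθ0) (hB a₀ θ₀ u₀ ha hθ hu ha0 hθ0)⟩

/-! ### Rung 0: the crux at global equilibrium from the two rung-0 leaves -/

/-- **`RateFloor` AT GLOBAL EQUILIBRIUM from the two rung-0 leaves** (the registered texts verbatim: hypothesis `hA` is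
S7a₀ `stub_noBurstsRung0`, hypothesis `hB` is S7b₀ `stub_staticOpacityFloorRung0`, the conclusion is `RateFloorRung0` —
the crux `RateFloor` restricted to constant profiles `(a, u, θ)`): `rateFloorAt_of` at the constant profiles, profile
by profile, with `g₀ := g₃`. [folklore] -/
theorem rateFloorRung0_of_leaves
    (hA : ∀ (a θ : ℝ) (u : Literature.MathematicalPhysics.KineticTheory.V3), 0 < a → 0 < θ → ∃ σ₀ : ℝ, 0 < σ₀ ∧ ∀ σ : ℝ, 0 < σ → σ < σ₀ → ∀ Φ : (N : ℕ) → Literature.Analysis.FluidPDE.HardSphereFlow (Literature.Analysis.FluidPDE.Torus.geometry (Fin 3)) (Literature.MathematicalPhysics.KineticTheory.hsDiameter σ N) (N + 1), ∀ τ : ℝ, 0 < τ → ∀ η δ : ℝ, 0 < η → 0 < δ → ∃ A : ℝ, 0 < A ∧ ∃ b : ℝ, 1 / 3 ≤ b ∧ b ≤ 1 ∧ ∃ N₀ : ℕ, ∀ N : ℕ, N₀ ≤ N → let ε := Literature.MathematicalPhysics.KineticTheory.hsDiameter σ N; let γ := fun z (s : ℝ) => (Φ N).flow s z; Literature.MathematicalPhysics.KineticTheory.localGibbsLaw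 σ (fun _ => a) (fun _ => u) (fun _ => θ) N (Φ N) {z | η < ε / (N + 1 : ℝ) * lineBursts ε (windowLenB A b N) τ (γ z)} ≤ ENNReal.ofReal δ)
    (hB : ∃ g₃ : ℝ, 0 < g₃ ∧ ∀ (a θ : ℝ) (u : Literature.MathematicalPhysics.KineticTheory.V3), 0 < a → 0 < θ → ∃ σ₀ : ℝ, 0 < σ₀ ∧ ∀ σ : ℝ, 0 < σ → σ < σ₀ → ∀ Φ : (N : ℕ) → Literature.Analysis.FluidPDE.HardSphereFlow (Literature.Analysis.FluidPDE.Torus.geometry (Fin 3)) (Literature.MathematicalPhysics.KineticTheory.hsDiameter σ N) (N + 1), ∀ τ : ℝ, 0 < τ → ∀ χ : ℝ × UnitAddTorus (Fin 3) → ℝ, Continuous χ → (∀ p, 0 ≤ χ p) → ∀ Ξ : EuclideanSpace ℝ (Fin 3) × EuclideanSpace ℝ (Fin 3) × EuclideanSpace ℝ (Fin 3) → ℝ, Continuous Ξ → (∀ q, 0 ≤ Ξ q) → (∃ C : ℝ, ∀ q, Ξ q ≤ C) → ∀ η δ : ℝ, 0 < η → 0 < δ → ∃ r₀ : ℝ,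 0 < r₀ ∧ ∀ r : ℝ, 0 < r → r < r₀ → ∀ A : ℝ, 0 < A → ∀ b : ℝ, 1 / 3 ≤ b → b ≤ 1 → ∃ N₀ : ℕ, ∀ N : ℕ, N₀ ≤ N → let ε := Literature.MathematicalPhysics.KineticTheory.hsDiameter σ N; let G := Literature.Analysis.FluidPDE.Torus.geometry (Fin 3); let γ := fun z (s : ℝ) => (Φ N).flow s z; let bx : UnitAddTorus (Fin 3) → UnitAddTorus (Fin 3) → ℝ := fun x y => 3 / (Real.pi * r ^ 3) * max (1 - Literature.Analysis.FluidPDE.Torus.euclidDist x y / r) 0; let Θ := fun (Ξ : EuclideanSpace ℝ (Fin 3) × EuclideanSpace ℝ (Fin 3) × EuclideanSpace ℝ (Fin 3) → ℝ) (v w : EuclideanSpace ℝ (Fin 3)) => ∫ ω : Metric.sphere (0 : EuclideanSpace ℝ (Fin 3)) 1, Ξ ((ω : EuclideanSpace ℝ (Fin 3)), v, w) * Literature.MathematicalPhysics.KineticTheory.hardSphereKernel (w, v) ω ∂Literature.MathematicalPhysics.KineticTheory.sphereMeasure; let B := fun Ξ z s (x₀ : UnitAddTorus (Fin 3)) =>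 ∫ p, bx p.1.1 x₀ * bx p.2.1 x₀ * Θ Ξ p.1.2 p.2.2 ∂((Literature.Analysis.FluidPDE.empiricalMeasure (γ z s)).prod (Literature.Analysis.FluidPDE.empiricalMeasure (γ z s))); let SW := fun (z : Literature.Analysis.FluidPDE.Config (N + 1) (Fin 3) Literature.MathematicalPhysics.KineticTheory.T3) => lineSW ε (windowLenB A b N) τ (γ z) (fun u x y v w => χ (u, x) * Ξ (ε⁻¹ • G.sepVec x y, v, w)); Literature.MathematicalPhysics.KineticTheory.localGibbsLaw σ (fun _ => a) (fun _ => u) (fun _ => θ) N (Φ N) {z | SW z < g₃ * σ ^ 3 * (∫ s in Set.Icc (0 : ℝ) τ, ∫ x : UnitAddTorus (Fin 3), χ (s, x) * B Ξ z s x) - η} ≤ ENNReal.ofReal δ) :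
    ∃ g₀ : ℝ, 0 < g₀ ∧ ∀ (a θ : ℝ) (u : Literature.MathematicalPhysics.KineticTheory.V3), 0 < a → 0 < θ → ∃ σ₀ : ℝ, 0 < σ₀ ∧ ∀ σ : ℝ, 0 < σ → σ < σ₀ → ∀ Φ : (N : ℕ) → Literature.Analysis.FluidPDE.HardSphereFlow (Literature.Analysis.FluidPDE.Torus.geometry (Fin 3)) (Literature.MathematicalPhysics.KineticTheory.hsDiameter σ N) (N + 1), ∀ τ : ℝ, 0 < τ → ∀ χ : ℝ × UnitAddTorus (Fin 3) → ℝ, Continuous χ → (∀ p, 0 ≤ χ p) → ∀ Ξ : EuclideanSpace ℝ (Fin 3) × EuclideanSpace ℝ (Fin 3) × EuclideanSpace ℝ (Fin 3) → ℝ, Continuous Ξ → (∀ q, 0 ≤ Ξ q) → (∃ C : ℝ, ∀ q, Ξ q ≤ C) → ∀ η δ : ℝ, 0 < η → 0 < δ → ∃ r₀ : ℝ, 0 < r₀ ∧ ∀ r : ℝ, 0 < r → r < r₀ → ∃ N₀ : ℕ, ∀ N : ℕ, N₀ ≤ N → let ε := Literature.MathematicalPhysics.KineticTheory.hsDiameter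 σ N; let G := Literature.Analysis.FluidPDE.Torus.geometry (Fin 3); let γ := fun z (s : ℝ) => (Φ N).flow s z; let bx : UnitAddTorus (Fin 3) → UnitAddTorus (Fin 3) → ℝ := fun x y => 3 / (Real.pi * r ^ 3) * max (1 - Literature.Analysis.FluidPDE.Torus.euclidDist x y / r) 0; let Θ := fun (Ξ : EuclideanSpace ℝ (Fin 3) × EuclideanSpace ℝ (Fin 3) × EuclideanSpace ℝ (Fin 3) → ℝ) (v w : EuclideanSpace ℝ (Fin 3)) => ∫ ω : Metric.sphere (0 : EuclideanSpace ℝ (Fin 3)) 1, Ξ ((ω : EuclideanSpace ℝ (Fin 3)), v, w) * Literature.MathematicalPhysics.KineticTheory.hardSphereKernel (w, v) ω ∂Literature.MathematicalPhysics.KineticTheory.sphereMeasure; let B := fun Ξ z s (x₀ : UnitAddTorus (Fin 3)) => ∫ p, bx p.1.1 x₀ * bx p.2.1 x₀ * Θ Ξ p.1.2 p.2.2 ∂((Literature.Analysis.FluidPDE.empiricalMeasure (γ z s)).prod (Literature.Analysis.FluidPDE.empiricalMeasure (γ z s))); let pv := fun z s (i j : Fin (N + 1)) => Literature.Analysis.FluidPDE.reflectVel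 (G.sepVec (γ z s i).1 (γ z s j).1) ((γ z s i).2, (γ z s j).2); let Kc := fun (Fn : Literature.Analysis.FluidPDE.Config (N + 1) (Fin 3) Literature.MathematicalPhysics.KineticTheory.T3 → ℝ → Fin (N + 1) → Fin (N + 1) → ℝ) z => ε / (N + 1 : ℝ) * ∑ᶠ (s : ℝ) (_ : s ∈ Literature.Analysis.FluidPDE.collisionTimes G ε (γ z) ∩ Set.Icc 0 τ), ∑ i : Fin (N + 1), ∑ j : Fin (N + 1), (if i ≠ j ∧ ‖G.sepVec (γ z s i).1 (γ z s j).1‖ = ε then Fn z s i j else 0); Literature.MathematicalPhysics.KineticTheory.localGibbsLaw σ (fun _ => a) (fun _ => u) (fun _ => θ) N (Φ N) {z | Kc (fun z s i j => χ (s, (γ z s i).1) * Ξ (ε⁻¹ • G.sepVec (γ z s i).1 (γ z s j).1, (pv z s i j).1, (pv z s i j).2)) z < g₀ * σ ^ 3 * (∫ s in Set.Icc (0 : ℝ) τ, ∫ x : UnitAddTorus (Fin 3), χ (s, x) * B Ξ z s x) - η} ≤ ENNReal.ofReal δ := by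
  obtain ⟨g₃, hg₃, hB⟩ := hB
  exact ⟨g₃, hg₃, fun a θ u ha hθ => rateFloorAt_of (hA a θ u ha hθ) (hB a θ u ha hθ)⟩

/-! ### `RateFloor` at global equilibrium — unconditional -/

/-- **`RateFloor` AT GLOBAL EQUILIBRIUM (constant profiles), UNCONDITIONALLY** — registered stub `stub_rateFloorRung0` of
crux stmt-AtomisticToContinuum-13080 (the crux `JParityClosure.RateFloor` with the profiles `a₀, u₀, θ₀` constant, everything
else verbatim): there is a universal `g₀ > 0` (here `g₀ = 1/8`) such that for the canonical hard-sphere gas of `N + 1` spheres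
on `𝕋³` at small reduced density `σ < σ₀(a, θ, u)`, along EVERY hard-sphere flow and for every horizon `τ`, continuous weight
`χ ≥ 0`, bounded continuous mark `Ξ ≥ 0` of `(n̂, v⁻, w⁻)` and every `η, δ > 0`, the normalised marked collision functional
`K_N[χ Ξ]` is at least `g₀ σ³ ∫₀^τ∫ χ B^Ξ_r − η` with probability `≥ 1 − δ` for `r < r₀` and `N ≥ N₀(r)`.  Proof: the line
`Sketch` — `K ≥ S_R ≥ S_W − (ε/(N+1)) M·Bursts` surely (S6a, S6d, S8, S10), no bursts at rung 0
(`RateFloorNoBursts.stub_noBurstsRung0`: three-label Ruelle statics + short-flight Palm bound + Gibbs invariance) and the static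
opacity floor at rung 0 (`RateFloorStaticFloor.stub_staticOpacityFloorRung0`: one-sided canonical pair bound, windowed four-label
decorrelation plateau from the two-cluster Kirkwood–Salsburg factorisation, tube Chebyshev + Markov over windows, r-scale LLN of
the B-side).  Not in print as a theorem about the deterministic many-body flow (a concentration statement for an additive
collision functional of the dilute hard-sphere dynamics in equilibrium); consistent with Enskog's `K/(σ³∫B) → Y(ρσ³) ≥ 1`.
[folklore] -/
theorem stub_rateFloorRung0 : ∃ g₀ : ℝ, 0 < g₀ ∧ ∀ (a θ : ℝ) (u : Literature.MathematicalPhysics.KineticTheory.V3), 0 < a → 0 < θ → ∃ σ₀ : ℝ, 0 < σ₀ ∧ ∀ σ : ℝ, 0 < σ → σ < σ₀ → ∀ Φ : (N : ℕ) → Literature.Analysis.FluidPDE.HardSphereFlow (Literature.Analysis.FluidPDE.Torus.geometry (Fin 3)) (Literature.MathematicalPhysics.KineticTheory.hsDiameter σ N) (N + 1), ∀ τ : ℝ, 0 < τ → ∀ χ : ℝ × UnitAddTorus (Fin 3) → ℝ, Continuous χ → (∀ p, 0 ≤ χ p) → ∀ Ξ : EuclideanSpace ℝ (Fin 3) ×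 EuclideanSpace ℝ (Fin 3) × EuclideanSpace ℝ (Fin 3) → ℝ, Continuous Ξ → (∀ q, 0 ≤ Ξ q) → (∃ C : ℝ, ∀ q, Ξ q ≤ C) → ∀ η δ : ℝ, 0 < η → 0 < δ → ∃ r₀ : ℝ, 0 < r₀ ∧ ∀ r : ℝ, 0 < r → r < r₀ → ∃ N₀ : ℕ, ∀ N : ℕ, N₀ ≤ N → let ε := Literature.MathematicalPhysics.KineticTheory.hsDiameter σ N; let G := Literature.Analysis.FluidPDE.Torus.geometry (Fin 3); let γ := fun z (s : ℝ) => (Φ N).flow s z; let bx : UnitAddTorus (Fin 3) → UnitAddTorus (Fin 3) → ℝ := fun x y => 3 / (Real.pi * r ^ 3) * max (1 - Literature.Analysis.FluidPDE.Torus.euclidDist x y / r) 0; let Θ := fun (Ξ : EuclideanSpace ℝ (Fin 3) × EuclideanSpace ℝ (Fin 3) × EuclideanSpace ℝ (Fin 3) → ℝ) (v w : EuclideanSpace ℝ (Fin 3)) => ∫ ω : Metric.sphere (0 : EuclideanSpace ℝ (Fin 3)) 1, Ξ ((ω : EuclideanSpace ℝ (Fin 3)), v, w) * Literature.MathematicalPhysics.KineticTheory.hardSphereKernel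 (w, v) ω ∂Literature.MathematicalPhysics.KineticTheory.sphereMeasure; let B := fun Ξ z s (x₀ : UnitAddTorus (Fin 3)) => ∫ p, bx p.1.1 x₀ * bx p.2.1 x₀ * Θ Ξ p.1.2 p.2.2 ∂((Literature.Analysis.FluidPDE.empiricalMeasure (γ z s)).prod (Literature.Analysis.FluidPDE.empiricalMeasure (γ z s))); let pv := fun z s (i j : Fin (N + 1)) => Literature.Analysis.FluidPDE.reflectVel (G.sepVec (γ z s i).1 (γ z s j).1) ((γ z s i).2, (γ z s j).2); let Kc := fun (Fn : Literature.Analysis.FluidPDE.Config (N + 1) (Fin 3) Literature.MathematicalPhysics.KineticTheory.T3 → ℝ → Fin (N + 1) → Fin (N + 1) → ℝ) z => ε / (N + 1 : ℝ) * ∑ᶠ (s : ℝ) (_ : s ∈ Literature.Analysis.FluidPDE.collisionTimes G ε (γ z) ∩ Set.Icc 0 τ), ∑ i : Fin (N + 1), ∑ j : Fin (N + 1), (if i ≠ j ∧ ‖G.sepVec (γ z s i).1 (γ z s j).1‖ = ε then Fn z s i j else 0); Literature.MathematicalPhysics.KineticTheory.localGibbsLaw σ (fun _ => a) (fun _ =>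 u) (fun _ => θ) N (Φ N) {z | Kc (fun z s i j => χ (s, (γ z s i).1) * Ξ (ε⁻¹ • G.sepVec (γ z s i).1 (γ z s j).1, (pv z s i j).1, (pv z s i j).2)) z < g₀ * σ ^ 3 * (∫ s in Set.Icc (0 : ℝ) τ, ∫ x : UnitAddTorus (Fin 3), χ (s, x) * B Ξ z s x) - η} ≤ ENNReal.ofReal δ :=
  rateFloorRung0_of_leaves RateFloorNoBursts.stub_noBurstsRung0 RateFloorStaticFloor.stub_staticOpacityFloorRung0

end RateFloorRung0

end Summit.AtomisticToContinuum.HydrodynamicLimit.Theorems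

end
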